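import Mathlib
import Summits.PneNP.PneNP.Theorems.OverlapGapAlgebraNoStableSectionIndep
import Summits.PneNP.PneNP.Theorems.SolvableImpliesStableSection.Negative.FalseWithoutSolvable

/-!
# Crux `SolvableImpliesStableSection` (stmt-PneNP-2463) — negative lemmas, part 4:
# valid sections must travel a LINEAR distance along every sweep (quantitative form of part 3)

Def-free.  Part 3 (`FalseAtEtaZero.lean`): a section frozen along a sweep (`η = 0`) fails at every
density.  Here the independence mechanism is made quantitative.  `card_validClose_lt`: for `k ≥ 1`, any
`α > 0`, `0 ≤ ν, β ≤ 1/2` and `c` with `h₂(β) + c < α((1-ν)2^{-k} - h₂(ν))`, eventually in `n`, for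
EVERY map `g`, the paths on which `g` is `ν`-valid along the Bresler–Huang path (validity conjunct of the
crux, verbatim) AND `d_H(g(Ψ 0), g(Ψ 1)) ≤ β n` are fewer than `e^{-cn} · #paths`: `g (Ψ 1)` lies in the
Hamming ball of radius `βn` about `g (Ψ 0)` — `≤ (βn+1)e^{n h₂(β)}` assignments fixed by `Ψ 0` — and must
be `ν`-valid for the INDEPENDENT array `Ψ 1` (`card_hammingBall_le`, `DartGame.ind_card_violCount_le`,
fibrewise product count `card_far_mem_le`).  `exists_separation`: hence for every `k ≥ 1`, `α > 0` some
`ν, β, c > 0` work.  For provers: on the crux's path event the section moves a total distance `> βn`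
along each sweep, so the budget `ηn` is spent on `≥ β/η` steps — stability can only come from spreading
a linear displacement thinly over the `mk` steps (as the landed local/Lipschitz sections do), never from
rigidity.  (Standing disprover gen-2; work file `Cruxes/…/Disproof.lean`.)
-/

set_option linter.dupNamespace false

namespace Summit.PneNP.PneNP.Cruxes.SolvableImpliesStableSection.Negative

open Finset
open Summit.PneNP.PneNP.Cruxes.NoStableSection.DartGame (violCount Inst PathSp ind_card_violCount_le)

section Counting

variable {k m n : ℕ}

/-- **Fibrewise product count.** If for every origin `a` the admissible far ends form a set `S a` with
`#(S a) ≤ D · #Inst`, then the paths with `Ψ 1 ∈ S (Ψ 0)` number at most `D · #paths` (`k ≥ 1`). -/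
theorem card_far_mem_le (hk : 1 ≤ k) (S : Inst m k n → Finset (Inst m k n)) {D : ℝ}
    (hD : ∀ a, ((S a).card : ℝ) ≤ D * Fintype.card (Inst m k n)) :
    ((univ.filter fun Ψ : PathSp k m n => Ψ (⟨0, hk⟩ : Fin k).succ ∈ S (Ψ 0)).card : ℝ) ≤
      D * Fintype.card (PathSp k m n) := by
  classical
  set r0 : Fin k := ⟨0, hk⟩ with hr0
  have hfib : ∀ a : Inst m k n,
      (((univ.filter fun Ψ : PathSp k m n => Ψ r0.succ ∈ S (Ψ 0)).filter
        fun Ψ => Ψ 0 = a).card : ℝ) ≤ (S a).card * (Fintype.card (Inst m k n) : ℝ) ^ (k - 1) := by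
    intro a
    set t : Fin (k + 1) → Finset (Inst m k n) :=
      fun i => if i = 0 then {a} else if i = r0.succ then S a else univ with ht
    have hsub' : ((univ.filter fun Ψ : PathSp k m n => Ψ r0.succ ∈ S (Ψ 0)).filter
        fun Ψ => Ψ 0 = a) ⊆ Fintype.piFinset t := by
      intro Ψ hΨ
      simp only [mem_filter, mem_univ, true_and] at hΨ
      obtain ⟨hmem, h0⟩ := hΨ
      rw [Fintype.mem_piFinset]
      intro i
      by_cases hi : i = 0
      · subst hi
        simp [ht, h0]
      · by_cases hi' : i = r0.succ
        · subst hi'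
          have : t r0.succ = S a := by simp [ht, Fin.succ_ne_zero]
          rw [this, ← h0]
          exact hmem
        · have : t i = univ := by simp [ht, hi, hi']
          rw [this]
          exact mem_univ _
    have hcardt : (Fintype.piFinset t).card = (S a).card * (Fintype.card (Inst m k n)) ^ (k - 1) := by
      rw [Fintype.card_piFinset, Fin.prod_univ_succ]
      have h0 : (t 0).card = 1 := by simp [ht]
      have hsucc : ∀ j : Fin k, (t j.succ).card =
          if j = r0 then (S a).card else Fintype.card (Inst m k n) := by
        intro j
        by_cases hj : j = r0
        · subst hj
          simp [ht, Fin.succ_ne_zero]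
        · have hne : j.succ ≠ r0.succ := fun h => hj (Fin.succ_inj.1 h)
          simp [ht, Fin.succ_ne_zero, hne, hj, card_univ]
      rw [h0, one_mul, prod_congr rfl fun j _ => hsucc j, ← mul_prod_erase univ _ (mem_univ r0)]
      rw [if_pos rfl, prod_congr rfl fun j hj => if_neg (ne_of_mem_erase hj), prod_const,
        card_erase_of_mem (mem_univ r0), card_univ, Fintype.card_fin]
    exact_mod_cast (card_le_card hsub').trans hcardt.le
  have hcardPaths : (Fintype.card (PathSp k m n) : ℝ) =
      (Fintype.card (Inst m k n) : ℝ) * ((Fintype.card (Inst m k n) : ℝ) *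
        (Fintype.card (Inst m k n) : ℝ) ^ (k - 1)) := by
    rw [Fintype.card_fun (α := Fin (k + 1)), Fintype.card_fin]
    push_cast
    rw [← pow_succ', ← pow_succ', Nat.sub_add_cancel hk]
  calc ((univ.filter fun Ψ : PathSp k m n => Ψ r0.succ ∈ S (Ψ 0)).card : ℝ)
      = ∑ a : Inst m k n, (((univ.filter fun Ψ : PathSp k m n => Ψ r0.succ ∈ S (Ψ 0)).filter
          fun Ψ => Ψ 0 = a).card : ℝ) := by
        rw [card_eq_sum_card_fiberwise (f := fun Ψ : PathSp k m n => Ψ 0) (t := univ)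
          fun _ _ => mem_univ _]
        push_cast
        rfl
    _ ≤ ∑ a : Inst m k n, ((S a).card : ℝ) * (Fintype.card (Inst m k n) : ℝ) ^ (k - 1) :=
        sum_le_sum fun a _ => hfib a
    _ ≤ ∑ _a : Inst m k n, D * Fintype.card (Inst m k n) * (Fintype.card (Inst m k n) : ℝ) ^ (k - 1) := by
        refine sum_le_sum fun a _ => ?_
        exact mul_le_mul_of_nonneg_right (hD a) (by positivity)
    _ = D * Fintype.card (PathSp k m n) := by
        rw [sum_const, card_univ, nsmul_eq_mul, hcardPaths]
        ring

/-- **Hamming balls:** `#{τ : d_H(x, τ) ≤ L} ≤ Σ_{j ≤ L} C(n, j)` (the difference set fixes `τ`). -/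
theorem card_hammingBall_le (x : Fin n → Bool) (L : ℕ) :
    ((univ.filter fun τ : Fin n → Bool => hammingDist x τ ≤ L).card : ℝ) ≤
      ∑ j ∈ range (L + 1), (n.choose j : ℝ) := by
  classical
  set D : (Fin n → Bool) → Finset (Fin n) := fun τ => univ.filter fun i => x i ≠ τ i with hDdef
  have hinj : Function.Injective D := by
    intro τ τ' h
    funext i
    have hi := congrArg (fun s : Finset (Fin n) => i ∈ s) h
    simp only [hDdef, mem_filter, mem_univ, true_and, eq_iff_iff] at hi
    revert hi
    cases x i <;> cases τ i <;> cases τ' i <;> decide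
  have himg : (univ.filter fun τ : Fin n → Bool => hammingDist x τ ≤ L).image D ⊆
      (range (L + 1)).biUnion fun j => powersetCard j univ := by
    intro s hs
    rw [mem_image] at hs
    obtain ⟨τ, hτ, rfl⟩ := hs
    simp only [mem_filter, mem_univ, true_and] at hτ
    rw [mem_biUnion]
    refine ⟨hammingDist x τ, mem_range.2 (Nat.lt_succ_of_le hτ), ?_⟩
    rw [mem_powersetCard]
    exact ⟨subset_univ _, rfl⟩
  calc ((univ.filter fun τ : Fin n → Bool => hammingDist x τ ≤ L).card : ℝ)
      = (((univ.filter fun τ : Fin n → Bool => hammingDist x τ ≤ L).image D).card : ℝ) := by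
        rw [card_image_of_injective _ hinj]
    _ ≤ (((range (L + 1)).biUnion fun j => powersetCard j (univ : Finset (Fin n))).card : ℝ) := by
        exact_mod_cast card_le_card himg
    _ ≤ ∑ j ∈ range (L + 1), ((powersetCard j (univ : Finset (Fin n))).card : ℝ) := by
        exact_mod_cast card_biUnion_le
    _ = ∑ j ∈ range (L + 1), (n.choose j : ℝ) := by
        refine sum_congr rfl fun j _ => ?_
        rw [card_powersetCard, card_univ, Fintype.card_fin]

/-- **Counting.** Paths on which `g (Ψ 1)` is `ν`-valid for `Ψ 1` and within `βn` of `g (Ψ 0)` are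
at most `(⌊βn⌋₊+1) e^{n h₂(β)} · (⌊νm⌋₊+1) e^{m h₂(ν)} e^{-2^{-k}(1-ν)m} · #paths` (`0 ≤ ν, β ≤ 1/2`). -/
theorem card_validClose_le (hk : 1 ≤ k) {ν β : ℝ} (hν0 : 0 ≤ ν) (hν2 : ν ≤ 2⁻¹) (hβ0 : 0 ≤ β)
    (hβ2 : β ≤ 2⁻¹) (g : Inst m k n → (Fin n → Bool)) :
    ((univ.filter fun Ψ : PathSp k m n =>
        (violCount (g (Ψ (⟨0, hk⟩ : Fin k).succ)) (Ψ (⟨0, hk⟩ : Fin k).succ) : ℝ) ≤ ν * m ∧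
        (hammingDist (g (Ψ 0)) (g (Ψ (⟨0, hk⟩ : Fin k).succ)) : ℝ) ≤ β * n).card : ℝ) ≤
      ((⌊β * n⌋₊ + 1) * Real.exp (n * Real.binEntropy β)) *
        (((⌊ν * m⌋₊ + 1) * Real.exp (m * Real.binEntropy ν)) *
          Real.exp (-((1 / 2 : ℝ) ^ k * ((1 - ν) * m)))) * Fintype.card (PathSp k m n) := by
  classical
  set r0 : Fin k := ⟨0, hk⟩ with hr0
  set J : ℕ := ⌊ν * m⌋₊ with hJdef
  set L : ℕ := ⌊β * n⌋₊ with hLdef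
  have hJ : (J : ℝ) ≤ ν * m := Nat.floor_le (by positivity)
  have hL : (L : ℝ) ≤ β * n := Nat.floor_le (by positivity)
  have hJm : J ≤ m := by
    have : (J : ℝ) ≤ m := hJ.trans (by nlinarith [Nat.cast_nonneg (α := ℝ) m])
    exact_mod_cast this
  set B : ℝ := (∑ j ∈ range (J + 1), (m.choose j : ℝ)) * (1 - (1 / 2 : ℝ) ^ k) ^ (m - J) with hB
  set V : ℝ := ∑ j ∈ range (L + 1), (n.choose j : ℝ) with hV
  have hB0 : 0 ≤ B := mul_nonneg (sum_nonneg fun _ _ => Nat.cast_nonneg _)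
    (pow_nonneg (sub_nonneg.2 (pow_le_one₀ (by norm_num) (by norm_num))) _)
  set S : Inst m k n → Finset (Inst m k n) := fun a => univ.filter fun Φ =>
    ∃ τ : Fin n → Bool, hammingDist (g a) τ ≤ L ∧ violCount τ Φ ≤ J with hS
  have hScard : ∀ a, ((S a).card : ℝ) ≤ V * B * Fintype.card (Inst m k n) := by
    intro a
    have hsub : S a ⊆ (univ.filter fun τ : Fin n → Bool => hammingDist (g a) τ ≤ L).biUnion
        fun τ => univ.filter fun Φ : Inst m k n => violCount τ Φ ≤ J := by
      intro Φ hΦ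
      simp only [hS, mem_filter, mem_univ, true_and] at hΦ
      obtain ⟨τ, hτ, hv⟩ := hΦ
      exact mem_biUnion.2 ⟨τ, by simp [hτ], by simp [hv]⟩
    calc ((S a).card : ℝ)
        ≤ ∑ τ ∈ univ.filter (fun τ : Fin n → Bool => hammingDist (g a) τ ≤ L),
            ((univ.filter fun Φ : Inst m k n => violCount τ Φ ≤ J).card : ℝ) := by
          exact_mod_cast (card_le_card hsub).trans card_biUnion_le
      _ ≤ ∑ _τ ∈ univ.filter (fun τ : Fin n → Bool => hammingDist (g a) τ ≤ L),
            B * Fintype.card (Inst m k n) :=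
          sum_le_sum fun τ _ => ind_card_violCount_le τ J
      _ = ((univ.filter fun τ : Fin n → Bool => hammingDist (g a) τ ≤ L).card : ℝ) *
            (B * Fintype.card (Inst m k n)) := by rw [sum_const, nsmul_eq_mul]
      _ ≤ V * (B * Fintype.card (Inst m k n)) :=
          mul_le_mul_of_nonneg_right (card_hammingBall_le (g a) L) (by positivity)
      _ = V * B * Fintype.card (Inst m k n) := by ring
  have hsub : (univ.filter fun Ψ : PathSp k m n =>
        (violCount (g (Ψ r0.succ)) (Ψ r0.succ) : ℝ) ≤ ν * m ∧
        (hammingDist (g (Ψ 0)) (g (Ψ r0.succ)) : ℝ) ≤ β * n) ⊆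
      univ.filter fun Ψ : PathSp k m n => Ψ r0.succ ∈ S (Ψ 0) := by
    intro Ψ hΨ
    simp only [mem_filter, mem_univ, true_and, hS] at hΨ ⊢
    exact ⟨g (Ψ r0.succ), Nat.le_floor hΨ.2, Nat.le_floor hΨ.1⟩
  have hVle : V ≤ (L + 1) * Real.exp (n * Real.binEntropy β) :=
    sum_choose_le_exp_binEntropy (m := n) hβ0 hβ2 hL
  have hBle : B ≤ ((J + 1) * Real.exp (m * Real.binEntropy ν)) *
      Real.exp (-((1 / 2 : ℝ) ^ k * ((1 - ν) * m))) := by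
    have hS' := sum_choose_le_exp_binEntropy (m := m) hν0 hν2 hJ
    have hG : (1 - (1 / 2 : ℝ) ^ k) ^ (m - J) ≤ Real.exp (-((1 / 2 : ℝ) ^ k * ((1 - ν) * m))) := by
      refine (one_sub_pow_le_exp hJm).trans (Real.exp_le_exp.2 ?_)
      have hp0 : 0 ≤ (1 / 2 : ℝ) ^ k := by positivity
      nlinarith
    have hsum0 : 0 ≤ ∑ j ∈ range (J + 1), (m.choose j : ℝ) := sum_nonneg fun _ _ => Nat.cast_nonneg _
    have hgeom0 : 0 ≤ (1 - (1 / 2 : ℝ) ^ k) ^ (m - J) :=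
      pow_nonneg (sub_nonneg.2 (pow_le_one₀ (by norm_num) (by norm_num))) _
    rw [hB]
    gcongr
  have hV0 : 0 ≤ V := sum_nonneg fun _ _ => Nat.cast_nonneg _
  calc ((univ.filter fun Ψ : PathSp k m n =>
        (violCount (g (Ψ r0.succ)) (Ψ r0.succ) : ℝ) ≤ ν * m ∧
        (hammingDist (g (Ψ 0)) (g (Ψ r0.succ)) : ℝ) ≤ β * n).card : ℝ)
      ≤ ((univ.filter fun Ψ : PathSp k m n => Ψ r0.succ ∈ S (Ψ 0)).card : ℝ) := by
        exact_mod_cast card_le_card hsub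
    _ ≤ V * B * Fintype.card (PathSp k m n) := card_far_mem_le hk S hScard
    _ ≤ ((L + 1) * Real.exp (n * Real.binEntropy β)) *
          (((J + 1) * Real.exp (m * Real.binEntropy ν)) *
            Real.exp (-((1 / 2 : ℝ) ^ k * ((1 - ν) * m)))) * Fintype.card (PathSp k m n) := by
        gcongr

end Counting

section Analytic

variable {k : ℕ}

/-- **Analytic comparison:** under the rate condition the bound of `card_validClose_le` is `< e^{-cn}`. -/
theorem eventually_closeMoment_lt {α ν β c : ℝ} (hα : 0 < α) (hν0 : 0 ≤ ν) (hν1 : ν ≤ 1)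
    (hβ0 : 0 ≤ β) (hβ1 : β ≤ 1)
    (hrate : Real.binEntropy β + c < α * ((1 - ν) * (1 / 2) ^ k - Real.binEntropy ν)) :
    ∀ᶠ n : ℕ in Filter.atTop,
      ((⌊β * n⌋₊ + 1) * Real.exp (n * Real.binEntropy β)) *
        (((⌊ν * ⌊α * n⌋₊⌋₊ + 1) * Real.exp (⌊α * n⌋₊ * Real.binEntropy ν)) *
          Real.exp (-((1 / 2 : ℝ) ^ k * ((1 - ν) * ⌊α * n⌋₊)))) < Real.exp (-(c * n)) := by
  set R : ℝ := (1 - ν) * (1 / 2) ^ k - Real.binEntropy ν with hR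
  set γ : ℝ := α * R - Real.binEntropy β - c with hγ
  have hγpos : 0 < γ := by rw [hγ]; linarith
  set C : ℝ := Real.log 2 + Real.log (α + 1) + |R| with hC
  have hC0 : 0 ≤ C := by
    have h1 : 0 ≤ Real.log (α + 1) := Real.log_nonneg (by linarith)
    have h2 : 0 ≤ |R| := abs_nonneg R
    have h3 : 0 ≤ Real.log 2 := Real.log_nonneg (by norm_num)
    linarith
  filter_upwards [eventually_log_le_mul (show 0 < γ / 8 by positivity),
    Filter.eventually_ge_atTop (⌈C * (4 / γ)⌉₊ + 1)] with n hlog hn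
  have hn1 : (1 : ℝ) ≤ n := by exact_mod_cast le_trans (Nat.le_add_left 1 _) hn
  have hnpos : (0 : ℝ) < n := by linarith
  set M : ℕ := ⌊α * (n : ℝ)⌋₊ with hM
  have hMle : (M : ℝ) ≤ α * n := Nat.floor_le (by positivity)
  have hMgt : α * n - 1 < M := by
    have := Nat.lt_floor_add_one (α * (n : ℝ))
    linarith
  have hM0 : (0 : ℝ) ≤ M := Nat.cast_nonneg M
  have hJle : (⌊ν * (M : ℝ)⌋₊ : ℝ) + 1 ≤ (α + 1) * n := by
    have h1 : (⌊ν * (M : ℝ)⌋₊ : ℝ) ≤ ν * M := Nat.floor_le (by positivity)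
    have h2 : ν * (M : ℝ) ≤ M := by nlinarith
    nlinarith
  have hLle : (⌊β * (n : ℝ)⌋₊ : ℝ) + 1 ≤ 2 * n := by
    have h1 : (⌊β * (n : ℝ)⌋₊ : ℝ) ≤ β * n := Nat.floor_le (by positivity)
    nlinarith
  have hMR : -((M : ℝ) * R) ≤ -(α * R * n) + |R| := by
    rcases le_or_gt 0 R with hR0 | hR0
    · rw [abs_of_nonneg hR0]
      nlinarith
    · rw [abs_of_neg hR0]
      nlinarith
  have hconst : C ≤ γ / 4 * n := by
    have h1 : ((⌈C * (4 / γ)⌉₊ : ℕ) : ℝ) + 1 ≤ n := by exact_mod_cast hn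
    have h2 : C * (4 / γ) ≤ ⌈C * (4 / γ)⌉₊ := Nat.le_ceil _
    have h3 : C * (4 / γ) ≤ n := by linarith
    have h4 := mul_le_mul_of_nonneg_right h3 (show 0 ≤ γ / 4 by positivity)
    have h5 : C * (4 / γ) * (γ / 4) = C := by field_simp
    linarith
  have hγn : 0 < γ * n := mul_pos hγpos hnpos
  have hJexp : (⌊ν * (M : ℝ)⌋₊ : ℝ) + 1 ≤ Real.exp (Real.log (α + 1) + Real.log n) := by
    rw [Real.exp_add, Real.exp_log (by positivity), Real.exp_log hnpos]
    exact hJle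
  have hLexp : (⌊β * (n : ℝ)⌋₊ : ℝ) + 1 ≤ Real.exp (Real.log 2 + Real.log n) := by
    rw [Real.exp_add, Real.exp_log (by norm_num), Real.exp_log hnpos]
    exact hLle
  have hJ0 : (0 : ℝ) ≤ (⌊ν * (M : ℝ)⌋₊ : ℝ) + 1 := by positivity
  have hL0 : (0 : ℝ) ≤ (⌊β * (n : ℝ)⌋₊ : ℝ) + 1 := by positivity
  calc (((⌊β * (n : ℝ)⌋₊ : ℝ) + 1) * Real.exp (n * Real.binEntropy β)) *
        ((((⌊ν * (M : ℝ)⌋₊ : ℝ) + 1) * Real.exp (M * Real.binEntropy ν)) *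
          Real.exp (-((1 / 2 : ℝ) ^ k * ((1 - ν) * M))))
      ≤ (Real.exp (Real.log 2 + Real.log n) * Real.exp (n * Real.binEntropy β)) *
          ((Real.exp (Real.log (α + 1) + Real.log n) * Real.exp (M * Real.binEntropy ν)) *
            Real.exp (-((1 / 2 : ℝ) ^ k * ((1 - ν) * M)))) := by gcongr
    _ = Real.exp ((Real.log 2 + Real.log n) + n * Real.binEntropy β +
          ((Real.log (α + 1) + Real.log n) - M * R)) := by
        rw [← Real.exp_add, ← Real.exp_add, ← Real.exp_add, ← Real.exp_add]
        congr 1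
        rw [hR]
        ring
    _ < Real.exp (-(c * n)) := Real.exp_lt_exp.2 (by nlinarith)

/-- An explicit small radius: for `0 < t ≤ 1/2`, `h₂(t²) < 3t` (`log t⁻¹ < t⁻¹`). -/
theorem binEntropy_sq_lt {t : ℝ} (ht0 : 0 < t) (ht2 : t ≤ 2⁻¹) : Real.binEntropy (t ^ 2) < 3 * t := by
  have ht1 : t < 1 := lt_of_le_of_lt ht2 (by norm_num)
  have hν0 : 0 < t ^ 2 := by positivity
  have hν1 : t ^ 2 ≤ 1 / 4 := by nlinarith
  have h1ν : 0 < 1 - t ^ 2 := by linarith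
  have hlogt : Real.log t⁻¹ < t⁻¹ := by
    have h := Real.log_le_sub_one_of_pos (inv_pos.2 ht0)
    linarith
  have hlog1 : Real.log (t ^ 2)⁻¹ = 2 * Real.log t⁻¹ := by
    rw [← inv_pow, Real.log_pow]
    push_cast
    ring
  have hlog2' : Real.log (1 - t ^ 2)⁻¹ ≤ (1 - t ^ 2)⁻¹ - 1 :=
    Real.log_le_sub_one_of_pos (inv_pos.2 h1ν)
  have hterm : (1 - t ^ 2) * Real.log (1 - t ^ 2)⁻¹ ≤ t ^ 2 := by
    calc (1 - t ^ 2) * Real.log (1 - t ^ 2)⁻¹ ≤ (1 - t ^ 2) * ((1 - t ^ 2)⁻¹ - 1) :=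
          mul_le_mul_of_nonneg_left hlog2' h1ν.le
      _ = t ^ 2 := by rw [mul_sub, mul_inv_cancel₀ h1ν.ne', mul_one]; ring
  have hmain : t ^ 2 * Real.log (t ^ 2)⁻¹ < 2 * t := by
    rw [hlog1]
    have h := mul_lt_mul_of_pos_left hlogt hν0
    rw [show t ^ 2 * t⁻¹ = t by rw [pow_two, mul_assoc, mul_inv_cancel₀ ht0.ne', mul_one]] at h
    nlinarith
  rw [Real.binEntropy]
  nlinarith

end Analytic

section Main

variable {k : ℕ}

/-- **Valid sections separate the sweep endpoints (rate form):** `k ≥ 1`, `α > 0`, `0 ≤ ν, β ≤ 1/2`,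
`h₂(β) + c < α((1-ν)2^{-k} - h₂(ν))` ⇒ eventually, for EVERY `g`, the paths on which `g` is `ν`-valid at
every splice point (the crux's validity conjunct, verbatim) and `d_H(g(Ψ 0), g(Ψ 1)) ≤ βn` are `< e^{-cn}·#paths`. -/
theorem card_validClose_lt (hk : 1 ≤ k) {α ν β c : ℝ} (hα : 0 < α) (hν0 : 0 ≤ ν) (hν2 : ν ≤ 2⁻¹)
    (hβ0 : 0 ≤ β) (hβ2 : β ≤ 2⁻¹)
    (hrate : Real.binEntropy β + c < α * ((1 - ν) * (1 / 2 : ℝ) ^ k - Real.binEntropy ν)) :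
    ∀ᶠ n : ℕ in Filter.atTop, ∀ g : (Fin ⌊α * n⌋₊ → Fin k → Fin n × Bool) → (Fin n → Bool),
      ((Finset.univ.filter fun Ψ : Fin (k + 1) → Fin ⌊α * n⌋₊ → Fin k → Fin n × Bool =>
        (let P : Fin k → ℕ → Fin ⌊α * n⌋₊ → Fin k → Fin n × Bool :=
          fun r q a b => if (a : ℕ) * k + b < q then Ψ r.succ a b else Ψ r.castSucc a b
        ∀ r : Fin k, ∀ q ≤ ⌊α * n⌋₊ * k, ((Finset.univ.filter fun i : Fin ⌊α * n⌋₊ =>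
          ∀ j, g (P r q) (P r q i j).1 ≠ (P r q i j).2).card : ℝ) ≤ ν * ⌊α * n⌋₊) ∧
        (hammingDist (g (Ψ 0)) (g (Ψ ⟨1, Nat.lt_succ_of_le hk⟩)) : ℝ) ≤ β * n).card : ℝ) <
      Real.exp (-(c * n)) * Fintype.card (Fin (k + 1) → Fin ⌊α * n⌋₊ → Fin k → Fin n × Bool) := by
  have hν1 : ν ≤ 1 := hν2.trans (by norm_num)
  have hβ1 : β ≤ 1 := hβ2.trans (by norm_num)
  filter_upwards [eventually_closeMoment_lt (k := k) hα hν0 hν1 hβ0 hβ1 hrate,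
    Filter.eventually_ge_atTop 1] with n hlt hn1 g
  have hcard := card_paths_pos k ⌊α * (n : ℝ)⌋₊ hn1
  have hle := card_validClose_le (k := k) (m := ⌊α * (n : ℝ)⌋₊) (n := n) hk hν0 hν2 hβ0 hβ2 g
  have e1 : (⟨0, hk⟩ : Fin k).succ = ⟨1, Nat.lt_succ_of_le hk⟩ := rfl
  refine lt_of_le_of_lt (le_trans ?_ hle) (mul_lt_mul_of_pos_right hlt hcard)
  refine Nat.cast_le.2 (Finset.card_le_card fun Ψ hΨ => ?_)
  simp only [Finset.mem_filter, Finset.mem_univ, true_and] at hΨ ⊢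
  obtain ⟨hval, hclose⟩ := hΨ
  refine ⟨?_, by rw [e1]; exact hclose⟩
  have hcond : ∀ (i : Fin ⌊α * (n : ℝ)⌋₊) (j : Fin k), ((i : ℕ) * k + (j : ℕ) < ⌊α * (n : ℝ)⌋₊ * k) := by
    intro i j
    have hi := i.isLt
    calc (i : ℕ) * k + j < (i : ℕ) * k + k := by have hj := j.isLt; omega
      _ = ((i : ℕ) + 1) * k := by ring
      _ ≤ ⌊α * (n : ℝ)⌋₊ * k := Nat.mul_le_mul_right k hi
  have h := hval ⟨0, hk⟩ (⌊α * (n : ℝ)⌋₊ * k) le_rfl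
  simp only [hcond, if_true] at h
  exact h

/-- **Separation, every density.** For every `k ≥ 1` and `α > 0` there are `ν, β, c > 0` such that
eventually, for every map `g`, the paths on which `g` is `ν`-valid along the path and its outputs at
`Ψ 0`, `Ψ 1` are within `β n` are fewer than `e^{-cn} · #paths`: a valid section moves a LINEAR total
distance along each sweep (explicitly `ν = β = t²`, `c = α2^{-k}/4`, `t = min(1/2, α2^{-k}/(12(1+α)))`). -/
theorem exists_separation (hk : 1 ≤ k) {α : ℝ} (hα : 0 < α) :
    ∃ ν : ℝ, 0 < ν ∧ ∃ β : ℝ, 0 < β ∧ ∃ c : ℝ, 0 < c ∧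
    ∀ᶠ n : ℕ in Filter.atTop, ∀ g : (Fin ⌊α * n⌋₊ → Fin k → Fin n × Bool) → (Fin n → Bool),
      ((Finset.univ.filter fun Ψ : Fin (k + 1) → Fin ⌊α * n⌋₊ → Fin k → Fin n × Bool =>
        (let P : Fin k → ℕ → Fin ⌊α * n⌋₊ → Fin k → Fin n × Bool :=
          fun r q a b => if (a : ℕ) * k + b < q then Ψ r.succ a b else Ψ r.castSucc a b
        ∀ r : Fin k, ∀ q ≤ ⌊α * n⌋₊ * k, ((Finset.univ.filter fun i : Fin ⌊α * n⌋₊ =>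
          ∀ j, g (P r q) (P r q i j).1 ≠ (P r q i j).2).card : ℝ) ≤ ν * ⌊α * n⌋₊) ∧
        (hammingDist (g (Ψ 0)) (g (Ψ ⟨1, Nat.lt_succ_of_le hk⟩)) : ℝ) ≤ β * n).card : ℝ) <
      Real.exp (-(c * n)) * Fintype.card (Fin (k + 1) → Fin ⌊α * n⌋₊ → Fin k → Fin n × Bool) := by
  set p : ℝ := (1 / 2 : ℝ) ^ k with hp
  have hp0 : 0 < p := by positivity
  have hαp : 0 < α * p := mul_pos hα hp0
  have h1α : 0 < 1 + α := by linarith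
  set t : ℝ := min 2⁻¹ (α * p / (12 * (1 + α))) with ht
  have ht0 : 0 < t := lt_min (by norm_num) (by positivity)
  have ht2 : t ≤ 2⁻¹ := min_le_left _ _
  have ht3 : t ≤ α * p / (12 * (1 + α)) := min_le_right _ _
  have f2 : 3 * t + 3 * (α * t) ≤ α * p / 4 := by
    have h12 : (0 : ℝ) < 12 * (1 + α) := by positivity
    have := (le_div_iff₀ h12).1 ht3
    nlinarith
  have hE := binEntropy_sq_lt ht0 ht2
  have f1 : α * Real.binEntropy (t ^ 2) < 3 * (α * t) := by
    have := mul_lt_mul_of_pos_left hE hα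
    linarith
  have htsq : t ^ 2 ≤ 1 / 4 := by nlinarith
  have f3 : α * p * t ^ 2 ≤ α * p / 4 := by nlinarith
  have hβ2 : t ^ 2 ≤ 2⁻¹ := by nlinarith
  refine ⟨t ^ 2, by positivity, t ^ 2, by positivity, α * p / 4, by positivity, ?_⟩
  have hrate : Real.binEntropy (t ^ 2) + α * p / 4 < α * ((1 - t ^ 2) * p - Real.binEntropy (t ^ 2)) := by
    nlinarith
  exact card_validClose_lt hk hα (by positivity) hβ2 (by positivity) hβ2 hrate
end Main

end Summit.PneNP.PneNP.Cruxes.SolvableImpliesStableSection.Negative
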